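import Summits.NavierStokesRegularity.NavierStokesRegularity.Theorems.TypeILiouvilleTypeIliouvilleNoTypeIIPressureFreeSlabNecessary
import Summits.NavierStokesRegularity.NavierStokesRegularity.Theorems.TypeILiouvilleTypeIliouvilleNoTypeIIASlabModL
import Summits.NavierStokesRegularity.NavierStokesRegularity.Theorems.TypeILiouvilleTypeIliouvilleNoTypeIINormalForm
import HarnessLib

/-!
# `NoTypeII ⇒ S₁′ ⇒ ASlab`, and `NoTypeII ⇔ S₁′ ⇔ ASlab` modulo the Liouville hard core
# (crux `TypeIliouvilleNoTypeII`, stmt-NavierStokesRegularity-0056; §B keep/kill calibration)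

Helper file (theorems only), companion of `…PressureFreeSlabNecessary.lean`, which proves at unit
viscosity that a Type-I blow-up of the 0056 frame obeys the pressure-free energy-Type-I slab clause
S₁′ (Albritton–Barker Lemma 2.5 + Remark 3.2, uniform in the centre).  Here:
* `isTypeIBlowup_viscosityNormalisation` — the Type-I rate ascends to the viscosity normalisation
  `ũ = timeRescale ν⁻¹ ν⁻¹ u` (adapted from the tree's `isTypeIBlowup_timeRescale`, restated to keep
  this file free of route-thesis imports);
* `pressureFreeSlab_of_isTypeIBlowup` — **hnec for S₁′** at every viscosity, in EXACTLY the
  hypothesis shape `hS ν T u p` of ns-typeII-p1's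
  `EternalSplit.typeIliouvilleNoTypeII_of_pressureFreeSlab_of_eternalLiouville` and ns-typeII-p2's
  `TypeIIZoom.typeIliouvilleNoTypeII_of_pressureFreeSlab_of_liouvilleL`;
* `cknAEssSlab_of_isTypeIBlowup` — **hnec for ASlab** (shape of p2's
  `TypeIIZoom.typeIliouvilleNoTypeII_of_cknAEssSlab_of_liouvilleL`);
* `pressureFreeSlab_of_typeIliouvilleNoTypeII`, `cknAEssSlab_of_typeIliouvilleNoTypeII` —
  `NoTypeII ⇒ (a-priori S₁′)`, `NoTypeII ⇒ (a-priori ASlab)`;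
* `typeIliouvilleNoTypeII_iff_pressureFreeSlab_of_eternalLiouville` — under EEL′: `NoTypeII ⇔ S₁′`;
* `typeIliouvilleNoTypeII_iff_pressureFreeSlab_of_liouvilleL`,
  `typeIliouvilleNoTypeII_iff_cknAEssSlab_of_liouvilleL` — under (L): `NoTypeII ⇔ S₁′ ⇔ ASlab`.

READING for the §B critics (K2c): every energy-Type-I slab candidate (ASlab, S₁′, any `A/C/E`
sub-clause) is a CONSEQUENCE of 0056 unconditionally and EQUIVALENT to it modulo the Liouville hard
core (L) (stmt-NavierStokesRegularity-10661) — weaker currency, never a strengthening; together with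
`…WeakL3Reach.lean` the REACH lattice reads `C2 ⇒ ASlab ⇐ S₁′ ⇐ C3 = 0056` unconditionally and
`ASlab ⇒ C3` modulo (L).  WHAT THIS IS NOT: not NS regularity; S₁′, ASlab, EEL′, (L) are OPEN.
[folklore]

References: Albritton–Barker 2019 (arXiv:1811.00502) Lemma 2.5, Remark 3.2; Koch–Nadirashvili–
Seregin–Šverák 2009 §1 (L), §6; Tao 2013, footnote 3 (viscosity normalisation).
-/

noncomputable section

-- the summit and its single problem share the name `NavierStokesRegularity` (D-0017 nested layout)
set_option linter.dupNamespace false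

open Set Function Filter Topology MeasureTheory Metric TopologicalSpace
open scoped NNReal ENNReal

namespace Summit.NavierStokesRegularity.NavierStokesRegularity.Theorems.TypeIliouvilleNoTypeII.SlabNecessary

open Literature.Analysis Literature.Analysis.FluidPDE

/-! ## The Type-I rate under the viscosity normalisation -/

-- adapted from Summits/…/Theorems/SelfMixingDichotomyCoherentScaleExclusionNoTypeII.lean
-- (`isTypeIBlowup_timeRescale`), restated here to avoid importing a route-thesis cone.
/-- **The `L∞` Type-I rate is preserved by the viscosity normalisation.** If
`‖u(t,x)‖ ≤ C/√(T−t)` near `T`, then `v(s,x) = ν⁻¹ u(s/ν, x)` (`timeRescale ν⁻¹ ν⁻¹ u`) satisfies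
`‖v(s,x)‖ ≤ √(ν⁻¹) C₊/√(νT − s)` near `νT` (`C₊ = max C 0`; `T − s/ν = ν⁻¹ (νT − s)`). [cite: Tao2011, footnote 3] -/
theorem isTypeIBlowup_viscosityNormalisation {ν T : ℝ} (hν : 0 < ν) {u : ℝ → (EuclideanSpace ℝ (Fin 3)) → (EuclideanSpace ℝ (Fin 3))}
    (h : IsTypeIBlowup u T) : IsTypeIBlowup (timeRescale ν⁻¹ ν⁻¹ u) (ν * T) := by
  obtain ⟨C, hC⟩ := h
  have hν0 : ν ≠ 0 := hν.ne'
  have hνi : 0 < ν⁻¹ := inv_pos.2 hν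
  -- `s ↦ ν⁻¹ s` maps `𝓝[<] (νT)` to `𝓝[<] T`
  have hmaps : MapsTo (fun s : ℝ => ν⁻¹ * s) (Iio (ν * T)) (Iio T) := by
    intro s hs
    calc ν⁻¹ * s < ν⁻¹ * (ν * T) := mul_lt_mul_of_pos_left hs hνi
      _ = T := by rw [← mul_assoc, inv_mul_cancel₀ hν0, one_mul]
  have htend : Tendsto (fun s : ℝ => ν⁻¹ * s) (𝓝[<] (ν * T)) (𝓝[<] T) := by
    have hcont : ContinuousWithinAt (fun s : ℝ => ν⁻¹ * s) (Iio (ν * T)) (ν * T) :=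
      (continuous_const.mul continuous_id).continuousWithinAt
    have := hcont.tendsto_nhdsWithin hmaps
    rwa [← mul_assoc, inv_mul_cancel₀ hν0, one_mul] at this
  refine ⟨Real.sqrt ν⁻¹ * max C 0, ?_⟩
  filter_upwards [htend.eventually hC, self_mem_nhdsWithin] with s hs hsT x
  have hsT' : 0 < ν * T - s := sub_pos.2 hsT
  have hTs : T - ν⁻¹ * s = ν⁻¹ * (ν * T - s) := by field_simp
  have hsq : Real.sqrt (T - ν⁻¹ * s) = Real.sqrt ν⁻¹ * Real.sqrt (ν * T - s) := by
    rw [hTs, Real.sqrt_mul hνi.le]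
  have h1 : ‖u (ν⁻¹ * s) x‖ ≤ max C 0 / Real.sqrt (T - ν⁻¹ * s) :=
    (hs x).trans (div_le_div_of_nonneg_right (le_max_left _ _) (Real.sqrt_nonneg _))
  have hsi : 0 < Real.sqrt ν⁻¹ := Real.sqrt_pos.2 hνi
  have hsνT : 0 < Real.sqrt (ν * T - s) := Real.sqrt_pos.2 hsT'
  rw [timeRescale_apply, norm_smul, Real.norm_eq_abs, abs_of_pos hνi]
  calc ν⁻¹ * ‖u (ν⁻¹ * s) x‖ ≤ ν⁻¹ * (max C 0 / Real.sqrt (T - ν⁻¹ * s)) :=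
        mul_le_mul_of_nonneg_left h1 hνi.le
    _ = ν⁻¹ * (max C 0 / (Real.sqrt ν⁻¹ * Real.sqrt (ν * T - s))) := by rw [hsq]
    _ = Real.sqrt ν⁻¹ * max C 0 / Real.sqrt (ν * T - s) := by
        have haa : Real.sqrt ν⁻¹ * Real.sqrt ν⁻¹ = ν⁻¹ := Real.mul_self_sqrt hνi.le
        generalize Real.sqrt ν⁻¹ = a at haa hsi ⊢
        rw [← haa]
        field_simp

/-! ## General viscosity: the S₁′-clause and the ASlab-clause are NECESSARY for the Type-I rate -/

open Summit.NavierStokesRegularity.NavierStokesRegularity.Theorems.TypeIliouvilleNoTypeII.EternalSplit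
  (isMaximalSmoothSolution_timeRescale_one typeIliouvilleNoTypeII_of_pressureFreeSlab_of_eternalLiouville)
open Summit.NavierStokesRegularity.NavierStokesRegularity.Theorems.TypeIliouvilleNoTypeII.TypeIIZoom
  (typeIliouvilleNoTypeII_of_pressureFreeSlab_of_liouvilleL eternalLiouvillePressureFree_of_liouvilleL
    typeIliouvilleNoTypeII_of_cknAEssSlab_of_liouvilleL)
open Summit.NavierStokesRegularity.NavierStokesRegularity.Theses.TypeILiouville (TypeIliouvilleL
  TypeIliouvilleNoTypeII)

variable {ν T : ℝ} {u : ℝ → (EuclideanSpace ℝ (Fin 3)) → (EuclideanSpace ℝ (Fin 3))} {p : ℝ → (EuclideanSpace ℝ (Fin 3)) → ℝ}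

/-- **hnec for S₁′: a Type-I blow-up obeys the pressure-free energy-Type-I slab clause.**  Let
`(u, p)` be a maximal smooth solution of Navier–Stokes (viscosity `ν > 0`, zero force) on
`ℝ³ × [0, T)`, Leray–Hopf from the rapidly decaying datum `u 0`, with the Type-I rate at `T`.  Then its
viscosity normalisation `ũ = timeRescale ν⁻¹ ν⁻¹ u` (`ũ(s, x) = ν⁻¹ u(s/ν, x)`, unit viscosity on
`[0, νT)`) has `A`, `C`, `E` bounded by a finite `I` on EVERY parabolic ball of a final slab
`(S₁, νT) × ℝ³` — VERBATIM the hypothesis `hS ν T u p` of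
`EternalSplit.typeIliouvilleNoTypeII_of_pressureFreeSlab_of_eternalLiouville` and of
`TypeIIZoom.typeIliouvilleNoTypeII_of_pressureFreeSlab_of_liouvilleL` (ns-typeII-p1 and -p2).  So the §B
clause S₁′ is NOT STRONGER than the hard core `NoTypeII`: every Type-I blow-up satisfies it
(Albritton–Barker Lemma 2.5 + Remark 3.2, made uniform in the centre). [cite: AlbrittonBarker2019, Lemma 2.5 and Remark 3.2 (arXiv:1811.00502 §2–§3)] -/
theorem pressureFreeSlab_of_isTypeIBlowup (hν : 0 < ν) (hT : 0 < T)
    (hmax : IsMaximalSmoothSolution ν 0 u p T) (hLH : IsLerayHopfOn T ν 0 (u 0) u)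
    (hdec : HasRapidSpatialDecay (u 0)) (hTI : IsTypeIBlowup u T) :
    ∃ S₁ : ℝ, S₁ < ν * T ∧ ∃ I : ℝ≥0∞, I ≠ ⊤ ∧
      (∀ r : ℝ, 0 < r → ∀ z : ℝ × (EuclideanSpace ℝ (Fin 3)),
        parabolicCylinder r z ⊆ Ioo S₁ (ν * T) ×ˢ univ →
        cknAEss r z (timeRescale ν⁻¹ ν⁻¹ u) ≤ I ∧ cknC r z (timeRescale ν⁻¹ ν⁻¹ u) ≤ I ∧
        cknE r z (fun s y => fderiv ℝ (timeRescale ν⁻¹ ν⁻¹ u s) y) ≤ I) := by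
  obtain ⟨hmaxv, hLHv, hdecv⟩ := isMaximalSmoothSolution_timeRescale_one hν hT hmax hLH hdec
  exact pressureFreeSlab_one_of_isTypeIBlowup (mul_pos hν hT) hmaxv.1 hLHv hdecv
    (isTypeIBlowup_viscosityNormalisation hν hTI)

/-- **hnec for ASlab: a Type-I blow-up obeys the `A`-slab clause** (the scaled local kinetic energy
of `ũ` bounded by a finite `I` on every parabolic ball of a final slab) — VERBATIM the hypothesis
`hS ν T u p` of `TypeIIZoom.typeIliouvilleNoTypeII_of_cknAEssSlab_of_liouvilleL` (ns-typeII-p2), and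
the clause reached from a weak-`L³` bound in `…WeakL3Reach.lean`. [cite: AlbrittonBarker2019, Lemma 2.5 and Remark 3.2 (arXiv:1811.00502 §2–§3)] -/
theorem cknAEssSlab_of_isTypeIBlowup (hν : 0 < ν) (hT : 0 < T)
    (hmax : IsMaximalSmoothSolution ν 0 u p T) (hLH : IsLerayHopfOn T ν 0 (u 0) u)
    (hdec : HasRapidSpatialDecay (u 0)) (hTI : IsTypeIBlowup u T) :
    ∃ S₁ : ℝ, S₁ < ν * T ∧ ∃ I : ℝ≥0∞, I ≠ ⊤ ∧
      ∀ r : ℝ, 0 < r → ∀ z : ℝ × (EuclideanSpace ℝ (Fin 3)),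
        parabolicCylinder r z ⊆ Ioo S₁ (ν * T) ×ˢ univ →
        cknAEss r z (timeRescale ν⁻¹ ν⁻¹ u) ≤ I := by
  obtain ⟨S₁, hS₁, I, hI, h⟩ := pressureFreeSlab_of_isTypeIBlowup hν hT hmax hLH hdec hTI
  exact ⟨S₁, hS₁, I, hI, fun r hr z hz => (h r hr z hz).1⟩

/-! ## The a-priori clauses by name: `NoTypeII ⇒ S₁′ ⇒ ASlab`, and equivalence modulo EEL′ / (L) -/

/-- **`NoTypeII ⇒ (a-priori S₁′)`**: the hard core `TypeIliouvilleNoTypeII`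
(stmt-NavierStokesRegularity-0056) implies the pressure-free energy-Type-I slab clause for every
maximal Leray–Hopf solution from rapidly decaying data (the hypothesis `hS` of the `eternal_split`
compositions). [cite: AlbrittonBarker2019, Lemma 2.5 and Remark 3.2 (arXiv:1811.00502 §2–§3)] -/
theorem pressureFreeSlab_of_typeIliouvilleNoTypeII (hII : TypeIliouvilleNoTypeII) :
    ∀ (ν T : ℝ), 0 < ν → 0 < T → ∀ (u : ℝ → (EuclideanSpace ℝ (Fin 3)) → (EuclideanSpace ℝ (Fin 3))) (p : ℝ → (EuclideanSpace ℝ (Fin 3)) → ℝ),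
      IsMaximalSmoothSolution ν 0 u p T → IsLerayHopfOn T ν 0 (u 0) u → HasRapidSpatialDecay (u 0) →
      ∃ S₁ : ℝ, S₁ < ν * T ∧ ∃ I : ℝ≥0∞, I ≠ ⊤ ∧
        (∀ r : ℝ, 0 < r → ∀ z : ℝ × (EuclideanSpace ℝ (Fin 3)),
          parabolicCylinder r z ⊆ Ioo S₁ (ν * T) ×ˢ univ →
          cknAEss r z (timeRescale ν⁻¹ ν⁻¹ u) ≤ I ∧ cknC r z (timeRescale ν⁻¹ ν⁻¹ u) ≤ I ∧
          cknE r z (fun s y => fderiv ℝ (timeRescale ν⁻¹ ν⁻¹ u s) y) ≤ I) :=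
  fun ν T hν hT u p hmax hLH hdec =>
    pressureFreeSlab_of_isTypeIBlowup hν hT hmax hLH hdec (hII ν T hν hT u p hmax hLH hdec)

/-- **`NoTypeII ⇒ (a-priori ASlab)`**: the hard core implies the `A`-slab clause for every maximal
Leray–Hopf solution from rapidly decaying data (the hypothesis `hS` of
`TypeIIZoom.typeIliouvilleNoTypeII_of_cknAEssSlab_of_liouvilleL`). [cite: AlbrittonBarker2019, Lemma 2.5 and Remark 3.2 (arXiv:1811.00502 §2–§3)] -/
theorem cknAEssSlab_of_typeIliouvilleNoTypeII (hII : TypeIliouvilleNoTypeII) :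
    ∀ (ν T : ℝ), 0 < ν → 0 < T → ∀ (u : ℝ → (EuclideanSpace ℝ (Fin 3)) → (EuclideanSpace ℝ (Fin 3))) (p : ℝ → (EuclideanSpace ℝ (Fin 3)) → ℝ),
      IsMaximalSmoothSolution ν 0 u p T → IsLerayHopfOn T ν 0 (u 0) u → HasRapidSpatialDecay (u 0) →
      ∃ S₁ : ℝ, S₁ < ν * T ∧ ∃ I : ℝ≥0∞, I ≠ ⊤ ∧
        ∀ r : ℝ, 0 < r → ∀ z : ℝ × (EuclideanSpace ℝ (Fin 3)),
          parabolicCylinder r z ⊆ Ioo S₁ (ν * T) ×ˢ univ →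
          cknAEss r z (timeRescale ν⁻¹ ν⁻¹ u) ≤ I :=
  fun ν T hν hT u p hmax hLH hdec =>
    cknAEssSlab_of_isTypeIBlowup hν hT hmax hLH hdec (hII ν T hν hT u p hmax hLH hdec)

/-- **The door-calculus biconditional of the line `eternal_split`, pressure-free currency: under EEL′,
`NoTypeII ⇔ (a-priori S₁′)`.**  EEL′ is the pressure-free eternal energy Liouville statement (a
bounded eternal Oseen-mild smooth divergence-free `v`, `‖v‖ ≤ 2`, with `A`, `C`, `E` bounded by a
finite constant on all parabolic balls has `v(0,0) = 0`); «⇐» is ns-typeII-p1's composition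
`typeIliouvilleNoTypeII_of_pressureFreeSlab_of_eternalLiouville`, «⇒» is
`pressureFreeSlab_of_typeIliouvilleNoTypeII` (unconditional).  So modulo EEL′ the §B clause S₁′ is
EXACTLY the hard core — neither weaker nor stronger. [folklore] -/
theorem typeIliouvilleNoTypeII_iff_pressureFreeSlab_of_eternalLiouville
    (hEEL : ∀ v : ℝ → (EuclideanSpace ℝ (Fin 3)) → (EuclideanSpace ℝ (Fin 3)),
      ContDiff ℝ (⊤ : ℕ∞) (uncurry v) → (∀ t, VectorCalculus.IsDivFree (v t)) →
      (∀ s t : ℝ, s < t → ∀ x, v t x = heatFlow (v s) (t - s) x - oseenDuhamel 1 s v v t x) →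
      (∀ t x, ‖v t x‖ ≤ 2) →
      (∃ I : ℝ≥0∞, I ≠ ⊤ ∧ ∀ r : ℝ, 0 < r → ∀ z : ℝ × (EuclideanSpace ℝ (Fin 3)),
        cknAEss r z v ≤ I ∧ cknC r z v ≤ I ∧ cknE r z (fun s y => fderiv ℝ (v s) y) ≤ I) →
      v 0 0 = 0) :
    TypeIliouvilleNoTypeII ↔
      ∀ (ν T : ℝ), 0 < ν → 0 < T → ∀ (u : ℝ → (EuclideanSpace ℝ (Fin 3)) → (EuclideanSpace ℝ (Fin 3))) (p : ℝ → (EuclideanSpace ℝ (Fin 3)) → ℝ),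
        IsMaximalSmoothSolution ν 0 u p T → IsLerayHopfOn T ν 0 (u 0) u → HasRapidSpatialDecay (u 0) →
        ∃ S₁ : ℝ, S₁ < ν * T ∧ ∃ I : ℝ≥0∞, I ≠ ⊤ ∧
          (∀ r : ℝ, 0 < r → ∀ z : ℝ × (EuclideanSpace ℝ (Fin 3)),
            parabolicCylinder r z ⊆ Ioo S₁ (ν * T) ×ˢ univ →
            cknAEss r z (timeRescale ν⁻¹ ν⁻¹ u) ≤ I ∧ cknC r z (timeRescale ν⁻¹ ν⁻¹ u) ≤ I ∧
            cknE r z (fun s y => fderiv ℝ (timeRescale ν⁻¹ ν⁻¹ u s) y) ≤ I) :=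
  ⟨pressureFreeSlab_of_typeIliouvilleNoTypeII,
    fun hS => typeIliouvilleNoTypeII_of_pressureFreeSlab_of_eternalLiouville hS hEEL⟩

/-- **Modulo KNSS's (L): `NoTypeII ⇔ (a-priori S₁′)`** (stmt-NavierStokesRegularity-0056 ⇔ the
pressure-free energy-Type-I slab clause, under the hard core `TypeIliouvilleL`,
stmt-NavierStokesRegularity-10661, which route `TypeILiouville` pays for anyway); «⇐» is
ns-typeII-p2's `typeIliouvilleNoTypeII_of_pressureFreeSlab_of_liouvilleL`. [cite: KochNadirashviliSereginSverak2009, §1 conjecture (L) and §6 (arXiv:0709.3599)] -/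
theorem typeIliouvilleNoTypeII_iff_pressureFreeSlab_of_liouvilleL (hL : TypeIliouvilleL) :
    TypeIliouvilleNoTypeII ↔
      ∀ (ν T : ℝ), 0 < ν → 0 < T → ∀ (u : ℝ → (EuclideanSpace ℝ (Fin 3)) → (EuclideanSpace ℝ (Fin 3))) (p : ℝ → (EuclideanSpace ℝ (Fin 3)) → ℝ),
        IsMaximalSmoothSolution ν 0 u p T → IsLerayHopfOn T ν 0 (u 0) u → HasRapidSpatialDecay (u 0) →
        ∃ S₁ : ℝ, S₁ < ν * T ∧ ∃ I : ℝ≥0∞, I ≠ ⊤ ∧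
          (∀ r : ℝ, 0 < r → ∀ z : ℝ × (EuclideanSpace ℝ (Fin 3)),
            parabolicCylinder r z ⊆ Ioo S₁ (ν * T) ×ˢ univ →
            cknAEss r z (timeRescale ν⁻¹ ν⁻¹ u) ≤ I ∧ cknC r z (timeRescale ν⁻¹ ν⁻¹ u) ≤ I ∧
            cknE r z (fun s y => fderiv ℝ (timeRescale ν⁻¹ ν⁻¹ u s) y) ≤ I) :=
  ⟨pressureFreeSlab_of_typeIliouvilleNoTypeII,
    fun hS => typeIliouvilleNoTypeII_of_pressureFreeSlab_of_liouvilleL hS hL⟩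

/-- **Modulo KNSS's (L): `NoTypeII ⇔ (a-priori ASlab)`** — the hard core is EQUIVALENT, under
`TypeIliouvilleL`, to ONE scalar a-priori estimate: the scaled local kinetic energy
`ess sup_t r⁻¹ ∫_{B_r} |ũ(t)|²` of the viscosity-normalised field bounded on the balls of a final slab;
«⇐» is ns-typeII-p2's `typeIliouvilleNoTypeII_of_cknAEssSlab_of_liouvilleL`, «⇒» is
`cknAEssSlab_of_typeIliouvilleNoTypeII` (unconditional).  For the §B critics: an ASlab / S₁′ /
energy-Type-I-slab candidate is K2c «weaker currency than 0056 unconditionally, ≡ 0056 modulo (L)»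
by kernel certificate. [cite: KochNadirashviliSereginSverak2009, §1 conjecture (L) and §6 (arXiv:0709.3599)] -/
theorem typeIliouvilleNoTypeII_iff_cknAEssSlab_of_liouvilleL (hL : TypeIliouvilleL) :
    TypeIliouvilleNoTypeII ↔
      ∀ (ν T : ℝ), 0 < ν → 0 < T → ∀ (u : ℝ → (EuclideanSpace ℝ (Fin 3)) → (EuclideanSpace ℝ (Fin 3))) (p : ℝ → (EuclideanSpace ℝ (Fin 3)) → ℝ),
        IsMaximalSmoothSolution ν 0 u p T → IsLerayHopfOn T ν 0 (u 0) u → HasRapidSpatialDecay (u 0) →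
        ∃ S₁ : ℝ, S₁ < ν * T ∧ ∃ I : ℝ≥0∞, I ≠ ⊤ ∧
          ∀ r : ℝ, 0 < r → ∀ z : ℝ × (EuclideanSpace ℝ (Fin 3)),
            parabolicCylinder r z ⊆ Ioo S₁ (ν * T) ×ˢ univ →
            cknAEss r z (timeRescale ν⁻¹ ν⁻¹ u) ≤ I :=
  ⟨cknAEssSlab_of_typeIliouvilleNoTypeII,
    fun hS => typeIliouvilleNoTypeII_of_cknAEssSlab_of_liouvilleL hS hL⟩

end Summit.NavierStokesRegularity.NavierStokesRegularity.Theorems.TypeIliouvilleNoTypeII.SlabNecessary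

end
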